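import Literature.Computability.AlgebraicComplexity.TensorSemiring
import HarnessLib

/-!
# The twisted star `𝔖_n(L)`: the two-format far-edge component, sandwiched against `⟨n,n,2L⟩`

Route `FarEdgeDescent` (decomposition cell `decomp-mm`, lens 2 «structural dichotomy», gen 16),
support for the aside `SubLogRate` (stmt-MatrixMultiplication-25371).

Gen 15 isolated the one in-CW escape from the far-edge rate `c₁/log k`: amortising the FORMAT
entropy of the x-shared stars of the Coppersmith–Winograd powers at the far edge `⟨1,k,1⟩`,
`k → ∞` — the question «Q-𝔖»: does the *format-twisted* star degenerate asymptotically to the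
coherent one?  This file types the minimal object of that question over the tree's coordinate
tensor calculus (`AsymptoticSpectrum.lean`):

* `twistedStar K n L` — the tensor `𝔖_n(L)` of the bilinear map `(X, (Y, Y')) ↦ (X·Y, Xᵀ·Y')`,
  `X ∈ K^{n×n}`, `Y, Y' ∈ K^{n×L}`: the x-shared star of the two leaves `⟨n,n,L⟩` (reading `X`)
  and `⟨n,n,L⟩` (reading `Xᵀ`), the leaf variables being private.  The coherent star (both leaves
  reading `X`) is `⟨n,n,2L⟩ = matMulTensor K n n (L + L)`.  For `L = 1` this is, up to the slot
  permutation `(z; x; y) ↦ (x; y; z)`, the «glued tensor `G_q`» of lens 1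
  (`NODE-SaturationLadder-g11.md` §1–3): the pencil `{Z ⊕ Zᵀ}` versus `{Z ⊕ Z} ≅ ⟨q,q,2⟩`.
* the RESTRICTIONS (explicit `0/1` matrices, no degeneration):
  `⟨n,n,L⟩ ≤ 𝔖_n(L)` (`tensorRestrictsTo_twistedStar_matMul`),
  `𝔖_n(L) ≤ ⟨n,n,L⟩ ⊕ ⟨n,n,L⟩` (`tensorRestrictsTo_directSum_matMul_twistedStar`),
  `⟨n,n,2L⟩ ≤ 𝔖_n(L) ⊕ 𝔖_n(L)` (`tensorRestrictsTo_directSum_twistedStar_matMul`);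
* hence for every universal spectral point `F` (`IsUniversalSpectralPoint`):
  `F⟨n,n,L⟩ ≤ F(𝔖_n(L)) ≤ 2·F⟨n,n,L⟩` and `F⟨n,n,2L⟩ ≤ 2·F(𝔖_n(L))`
  (`spectralPoint_twistedStar_sandwich`): the twisted and the coherent star agree up to a factor
  `2` at EVERY point of the asymptotic spectrum;
* the Kronecker factorisation `𝔖_n(L) ≡ 𝔖_n(1) ⊗ ⟨1,1,L⟩` as mutual restrictions
  (`tensorRestrictsTo_kronecker_twistedStar_one`, `tensorRestrictsTo_twistedStar_kronecker_one`),
  so that `F(𝔖_n(L)) = F(𝔖_n(1)) · F⟨1,1,L⟩` (`spectralPoint_twistedStar_eq_mul`);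
* the typed question «transpose cashing» `AC_n(L)`: `F⟨n,n,2L⟩ ≤ F(𝔖_n(L))` for every
  universal spectral point `F` (by Strassen's spectral theorem this is asymptotic degeneration
  `𝔖_n(L) ≳ ⟨n,n,2L⟩`; an OPEN statement, defined nowhere and asserted nowhere in this file —
  it is the intended signature of a route aside) — with the proved pointwise reduction to `L = 1`
  (`spectralPoint_transposeCashing_iff_one`, `transposeCashing_iff_one`) and the proved
  factor-`2` version (`transposeCashing_upToTwo`).

Informal placement (NODE-v16.md of the cell): both tensors are free and tight with identical
quantum functionals, so transpose cashing is implied by Strassen's support-functional conjecture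
and refutable only by a new spectral separation — it is «spectrally invisible».

## References

* M. Christandl, P. Vrana, J. Zuiddam, *Universal points in the asymptotic spectrum of tensors*,
  J. AMS 36 (2023) = arXiv:1709.07851, §1.1–§1.2. [ChristandlVranaZuiddam2023]
* V. Strassen, *The asymptotic spectrum of tensors*, J. reine angew. Math. 384 (1988), 102–152.
  [Strassen1988]
* M. Bläser, *Fast Matrix Multiplication*, Theory of Computing Library, Graduate Surveys 5 (2013),
  §5, Def. 7.2. [Blaser2013]
## Landing note (decomp-mm-lander-1 g2, mechanical edits only — no mathematical change)

The lens-2 gen-16 kernel `FarEdgeDescentTwistedStar.lean` (446 lines, sha256 `3e9cbf4a3107cfda…`) exceeds the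
400-line limit for Theorems files, so it lands as a two-part import chain with byte-identical statements and
tactic lines: THIS part (`FarEdgeDescentTwistedStarCore`) = the restriction lemma `tensorRestrictsTo_precomp_add`, the
definition `twistedStar`, the leaves, both halves of the sandwich, the padding and the factor-`2` spectral sandwich
`spectralPoint_twistedStar_sandwich`; part 2 (`FarEdgeDescentTwistedStar`, imports this file) = the Kronecker
factorisation `𝔖_n(L) ≡ 𝔖_n(1) ⊗ ⟨1,1,L⟩`, the reduction of transpose cashing to `L = 1` and
`transposeCashing_upToTwo`.  Gate-forced edits: (i) one-line docstrings on the seven decls the docstring lint named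
(`twistedStar_inl_inl/_inr_inr/_inl_inr/_inr_inl`, `sandwichMap_apply`, `one_le_spectralPoint_matMul_one_one`,
`toKronIdx₂_apply`); (ii) `dedup.landed`: the global folklore unfolding lemma `matMulTensor_apply'`
(`matMulTensor K k m n a b c = if … then 1 else 0`, `rfl`) restates the landed
`Literature.…HopcroftKerrRow.matMulTensor_slice_apply`, which is stated over `[Field K]` and therefore cannot be
imported at this file's generality `[CommSemiring K]`; it is deleted and re-introduced as a LOCAL
`have matMulTensor_apply' … := fun _ _ _ _ _ _ => rfl` at the top of each proof whose `simp` set names it (2 here,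
5 in part 2), so every original tactic line is unchanged.  Same namespace `Summit.MatrixMultiplication.MatrixMultiplication.Theorems.FarEdgeDescentTwistedStar` in both parts.
-/

noncomputable section

open scoped BigOperators

set_option linter.dupNamespace false

namespace Summit.MatrixMultiplication.MatrixMultiplication.Theorems.FarEdgeDescentTwistedStar

open Literature.Computability.AlgebraicComplexity

universe u

/-! ## A restriction along index maps with a two-point substitution in the middle slot -/

section PrecompAdd

variable {K : Type u} [CommSemiring K]
variable {ι κ μ ι' κ' μ' : Type*}

/-- **Relabelling with one identification is a restriction**: for index maps `f, h` and TWO maps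
`g₁, g₂` on the middle slot, `t ≥ (t (f a) (g₁ b) (h c) + t (f a) (g₂ b) (h c))_{a,b,c}` — the
substitution sending the source variable `x_b` to the sum of the target variables `b'` with
`g₁ b' = b` or `g₂ b' = b` (matrices `A = f^*`, `B = g₁^* + g₂^*`, `C = h^*`; Bläser 2013,
Def. 7.2). [cite: Blaser2013, Def. 7.2] -/
theorem tensorRestrictsTo_precomp_add [Fintype ι] [Fintype κ] [Fintype μ] [DecidableEq ι]
    [DecidableEq κ] [DecidableEq μ] (t : ι → κ → μ → K) (f : ι' → ι) (g₁ g₂ : κ' → κ)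
    (h : μ' → μ) :
    TensorRestrictsTo t (fun a b c => t (f a) (g₁ b) (h c) + t (f a) (g₂ b) (h c)) := by
  have key : ∀ (g : κ' → κ) (a' : ι') (b' : κ') (c' : μ'),
      (∑ a, ∑ b, ∑ c, (if f a' = a then (1 : K) else 0) * (if g b' = b then (1 : K) else 0) *
        (if h c' = c then (1 : K) else 0) * t a b c) = t (f a') (g b') (h c') := by
    intro g a' b' c'
    rw [Finset.sum_eq_single (f a') (fun a _ ha => by simp [Ne.symm ha]) (by simp),
      Finset.sum_eq_single (g b') (fun b _ hb => by simp [Ne.symm hb]) (by simp),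
      Finset.sum_eq_single (h c') (fun c _ hc => by simp [Ne.symm hc]) (by simp)]
    simp
  refine ⟨fun a' a => if f a' = a then 1 else 0,
    fun b' b => (if g₁ b' = b then 1 else 0) + (if g₂ b' = b then 1 else 0),
    fun c' c => if h c' = c then 1 else 0, fun a' b' c' => ?_⟩
  simp only [mul_add, add_mul, Finset.sum_add_distrib]
  rw [key g₁, key g₂]

end PrecompAdd

/-! ## The twisted star -/

section TwistedStar

variable (K : Type u) [CommSemiring K]

/-- **The twisted star `𝔖_n(L)`.**  Slots as for `matMulTensor` (`z`-variables; `x`; `y`):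
slot 2 is the shared matrix `X ∈ K^{n×n}` (index `(row, column)`); slot 3 carries the private
leaf variables `Y ⊕ Y'`, slot 1 the private leaf variables `Z ⊕ Z'` (each block `≅ K^{n×L}`).
Leaf `inl` is `⟨n,n,L⟩` itself (`∑ Z_{κν} X_{κμ} Y_{μν}`: `Y` indexed by the column of `X`, `Z` by
its row); leaf `inr` is `⟨n,n,L⟩` read through `Xᵀ` (`∑ Z'_{μν} X_{κμ} Y'_{κν}`: `Y'` indexed by
the ROW of `X`, `Z'` by its column); mixed blocks vanish.  The tensor of
`(X, (Y, Y')) ↦ (XY, XᵀY')`. [cite: Blaser2013, §5 (the tensor ⟨k,m,n⟩)] -/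
def twistedStar (n L : ℕ) :
    (Fin n × Fin L) ⊕ (Fin n × Fin L) → Fin n × Fin n → (Fin n × Fin L) ⊕ (Fin n × Fin L) → K
  | Sum.inl a, b, Sum.inl c => matMulTensor K n n L a b c
  | Sum.inr a, b, Sum.inr c => matMulTensor K n n L a b.swap c
  | _, _, _ => 0

variable {K}

/-- The coherent block of `𝔖_n(L)` is the leaf `⟨n,n,L⟩` (definitional unfolding). [folklore] -/
@[simp] theorem twistedStar_inl_inl (n L : ℕ) (a : Fin n × Fin L) (b : Fin n × Fin n)
    (c : Fin n × Fin L) : twistedStar K n L (Sum.inl a) b (Sum.inl c) = matMulTensor K n n L a b c :=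
  rfl

/-- The twisted block of `𝔖_n(L)` is the leaf `⟨n,n,L⟩` read through `Xᵀ` (definitional unfolding). [folklore] -/
@[simp] theorem twistedStar_inr_inr (n L : ℕ) (a : Fin n × Fin L) (b : Fin n × Fin n)
    (c : Fin n × Fin L) :
    twistedStar K n L (Sum.inr a) b (Sum.inr c) = matMulTensor K n n L a b.swap c :=
  rfl

/-- The mixed block `(inl, inr)` of `𝔖_n(L)` vanishes (definitional unfolding). [folklore] -/
@[simp] theorem twistedStar_inl_inr (n L : ℕ) (a : Fin n × Fin L) (b : Fin n × Fin n)
    (c : Fin n × Fin L) : twistedStar K n L (Sum.inl a) b (Sum.inr c) = 0 :=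
  rfl

/-- The mixed block `(inr, inl)` of `𝔖_n(L)` vanishes (definitional unfolding). [folklore] -/
@[simp] theorem twistedStar_inr_inl (n L : ℕ) (a : Fin n × Fin L) (b : Fin n × Fin n)
    (c : Fin n × Fin L) : twistedStar K n L (Sum.inr a) b (Sum.inl c) = 0 :=
  rfl

/-! ### The leaves: `⟨n,n,L⟩ ≤ 𝔖_n(L)` (twice) -/

/-- **`𝔖_n(L) ≥ ⟨n,n,L⟩`** (restrict to the coherent leaf: kill `Y', Z'`). [folklore] -/
theorem tensorRestrictsTo_twistedStar_matMul (n L : ℕ) :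
    TensorRestrictsTo (twistedStar K n L) (matMulTensor K n n L) := by
  have e : (fun a b c => twistedStar K n L (Sum.inl a) (id b) (Sum.inl c)) =
      matMulTensor K n n L := by
    funext a b c; rfl
  rw [← e]
  exact tensorRestrictsTo_precomp _ _ _ _

/-- **`𝔖_n(L) ≥ ⟨n,n,L⟩`** through the twisted leaf (kill `Y, Z`, read `X` transposed).
[folklore] -/
theorem tensorRestrictsTo_twistedStar_matMul' (n L : ℕ) :
    TensorRestrictsTo (twistedStar K n L) (matMulTensor K n n L) := by
  have e : (fun a b c => twistedStar K n L (Sum.inr a) (Prod.swap b) (Sum.inr c)) =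
      matMulTensor K n n L := by
    funext a b c
    simp [Prod.swap_swap]
  rw [← e]
  exact tensorRestrictsTo_precomp _ _ _ _

/-! ### Upper half of the sandwich: `𝔖_n(L) ≤ ⟨n,n,L⟩ ⊕ ⟨n,n,L⟩` -/

/-- **`⟨n,n,L⟩ ⊕ ⟨n,n,L⟩ ≥ 𝔖_n(L)`**: identify the two `x`-blocks of the direct sum, the first
with `X`, the second with `Xᵀ` (the gluing of an x-shared star is a restriction of the direct sum
of its leaves). [folklore] -/
theorem tensorRestrictsTo_directSum_matMul_twistedStar (n L : ℕ) :
    TensorRestrictsTo (directSumTensor (matMulTensor K n n L) (matMulTensor K n n L))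
      (twistedStar K n L) := by
  have e : (fun a b c =>
      directSumTensor (matMulTensor K n n L) (matMulTensor K n n L) (id a) (Sum.inl b) (id c) +
        directSumTensor (matMulTensor K n n L) (matMulTensor K n n L) (id a) (Sum.inr b.swap)
          (id c)) = twistedStar K n L := by
    funext a b c
    rcases a with a | a <;> rcases c with c | c <;> simp [directSumTensor]
  rw [← e]
  exact tensorRestrictsTo_precomp_add _ _ _ _ _

/-! ### Lower half of the sandwich: `⟨n,n,2L⟩ ≤ 𝔖_n(L) ⊕ 𝔖_n(L)` -/

/-- The `z`/`y`-index map of the lower sandwich on `Fin n × (Fin L ⊕ Fin L)`: the first `L`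
inner indices go to the coherent leaf of the first copy, the last `L` to the twisted leaf of the
second copy. [folklore] -/
def sandwichCore (n L : ℕ) :
    Fin n × (Fin L ⊕ Fin L) → ((Fin n × Fin L) ⊕ (Fin n × Fin L)) ⊕ ((Fin n × Fin L) ⊕ (Fin n × Fin L))
  | (i, Sum.inl m) => Sum.inl (Sum.inl (i, m))
  | (i, Sum.inr m) => Sum.inr (Sum.inr (i, m))

/-- The same map on `Fin n × Fin (L + L)` (through `finSumFinEquiv`). [folklore] -/
def sandwichMap (n L : ℕ) (p : Fin n × Fin (L + L)) :
    ((Fin n × Fin L) ⊕ (Fin n × Fin L)) ⊕ ((Fin n × Fin L) ⊕ (Fin n × Fin L)) :=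
  sandwichCore n L (p.1, finSumFinEquiv.symm p.2)

/-- `sandwichMap` evaluated on an inner index presented through `finSumFinEquiv`. [folklore] -/
theorem sandwichMap_apply (n L : ℕ) (i : Fin n) (x : Fin L ⊕ Fin L) :
    sandwichMap n L (i, finSumFinEquiv x) = sandwichCore n L (i, x) := by
  simp only [sandwichMap, Equiv.symm_apply_apply]

/-- **`𝔖_n(L) ⊕ 𝔖_n(L) ≥ ⟨n,n,L+L⟩`**: the first copy contributes its coherent leaf (reading `X`),
the second copy its twisted leaf fed with `Xᵀ` (so that it, too, reads `X` coherently); the two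
`x`-blocks are identified accordingly. [folklore] -/
theorem tensorRestrictsTo_directSum_twistedStar_matMul (n L : ℕ) :
    TensorRestrictsTo (directSumTensor (twistedStar K n L) (twistedStar K n L))
      (matMulTensor K n n (L + L)) := by
  -- landed-duplicate guard (lander): the folklore unfolding lemma as a local hypothesis, `rfl`
  have matMulTensor_apply' : ∀ (k m n : ℕ) (a : Fin k × Fin n) (b : Fin k × Fin m) (c : Fin m × Fin n),
      matMulTensor K k m n a b c = if a.1 = b.1 ∧ b.2 = c.1 ∧ a.2 = c.2 then 1 else 0 :=
    fun _ _ _ _ _ _ => rfl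
  have e : (fun a b c =>
      directSumTensor (twistedStar K n L) (twistedStar K n L) (sandwichMap n L a) (Sum.inl b)
          (sandwichMap n L c) +
        directSumTensor (twistedStar K n L) (twistedStar K n L) (sandwichMap n L a)
          (Sum.inr b.swap) (sandwichMap n L c)) = matMulTensor K n n (L + L) := by
    funext a b c
    obtain ⟨i, ν⟩ := a
    obtain ⟨j, ν'⟩ := c
    obtain ⟨x, rfl⟩ := finSumFinEquiv.surjective ν
    obtain ⟨x', rfl⟩ := finSumFinEquiv.surjective ν'
    simp only [sandwichMap_apply, matMulTensor_apply', EmbeddingLike.apply_eq_iff_eq]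
    rcases x with m | m <;> rcases x' with m' | m' <;>
      simp [sandwichCore, directSumTensor, matMulTensor_apply', Prod.swap]
  rw [← e]
  exact tensorRestrictsTo_precomp_add _ _ _ _ _

/-! ### Padding: `⟨n,n,L⟩ ≤ ⟨n,n,L+L⟩` -/

/-- `⟨n,n,L+L⟩ ≥ ⟨n,n,L⟩` (zero-padding the inner dimension). [folklore] -/
theorem tensorRestrictsTo_matMul_double_matMul (n L : ℕ) :
    TensorRestrictsTo (matMulTensor K n n (L + L)) (matMulTensor K n n L) := by
  -- landed-duplicate guard (lander): the folklore unfolding lemma as a local hypothesis, `rfl`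
  have matMulTensor_apply' : ∀ (k m n : ℕ) (a : Fin k × Fin n) (b : Fin k × Fin m) (c : Fin m × Fin n),
      matMulTensor K k m n a b c = if a.1 = b.1 ∧ b.2 = c.1 ∧ a.2 = c.2 then 1 else 0 :=
    fun _ _ _ _ _ _ => rfl
  have e : (fun a b c => matMulTensor K n n (L + L) (Prod.map id (Fin.castAdd L) a) (id b)
      (Prod.map id (Fin.castAdd L) c)) = matMulTensor K n n L := by
    funext a b c
    simp [matMulTensor_apply', Fin.ext_iff]
  rw [← e]
  exact tensorRestrictsTo_precomp _ _ _ _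

/-! ### Spectral consequences -/

/-- **The factor-`2` sandwich at every universal spectral point.**  For every `F` in the
asymptotic spectrum: `F⟨n,n,L⟩ ≤ F(𝔖_n(L)) ≤ 2·F⟨n,n,L⟩` and `F⟨n,n,L+L⟩ ≤ 2·F(𝔖_n(L))`
(monotonicity under the three restrictions and additivity under `⊕`).
[cite: ChristandlVranaZuiddam2023, §1.2] -/
theorem spectralPoint_twistedStar_sandwich {K : Type} [CommSemiring K] {F : SpectralMap K}
    (hF : IsUniversalSpectralPoint K F) (n L : ℕ) :
    F (matMulTensor K n n L) ≤ F (twistedStar K n L) ∧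
      F (twistedStar K n L) ≤ 2 * F (matMulTensor K n n L) ∧
      F (matMulTensor K n n (L + L)) ≤ 2 * F (twistedStar K n L) := by
  refine ⟨hF.mono _ _ (tensorRestrictsTo_twistedStar_matMul n L), ?_, ?_⟩
  · have h := hF.mono _ _ (tensorRestrictsTo_directSum_matMul_twistedStar (K := K) n L)
    rw [hF.map_directSum] at h
    linarith
  · have h := hF.mono _ _ (tensorRestrictsTo_directSum_twistedStar_matMul (K := K) n L)
    rw [hF.map_directSum] at h
    linarith

end TwistedStar

end Summit.MatrixMultiplication.MatrixMultiplication.Theorems.FarEdgeDescentTwistedStar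

end
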